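import Summits.Ventures.CertifiedManyBodySolver.Theorems.TcThermcert1FreeGasSectorBounds
import Summits.HubbardSuperconductivity.HubbardSuperconductivity.Theorems.WidthHaldaneTubeSectorPartitionBlock
import HarnessLib

/-!
# Free-gas (`U = 0`) current clustering for TcThermcert1's Hypothesis C — part 4: the current covariance bound (generic `Λ`)

Helper file for route `TcThermcert1` (crux K1′ `ThermalStiffnessCeilingU8b8_le_7o44`, item `stmt-Ventures-24560`; line
`Cruxes/ThermalStiffnessCeilingU8b8_le_7o44/Lines/gauge_qbp_far_seam.lean` v1.4, Hypothesis C = `CurrentClustering U n β ξ`).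
GENERIC in the finite site set `Λ`; `h` symmetric, spin-diagonal, rows of absolute sum `≤ κ`, non-zero entries at `D`-distance `≤ 1`.

* §1 **Per-spin current bound.** Along any annihilator-intertwined family `P_m` (`P_m c_{xσ} = c_{xσ} P_{m+1}`, `c_{xσ} P_0 = 0`) whose
  weights `Z_m ≥ ‖·‖`-dominate `B ↦ tr(P_m e^{−βdΓ(h)} B)` and satisfy the ratio bound `Z_{M−i} ≤ ρ^i Z_M`: for `A` even on `orbSet X` and
  bond sites `a, b` at `D`-distance `≥ d` from `X`,
  `|tr(P_M e^{−βdΓ(h)} A j_σ)| ≤ 4‖A‖ |X| q^d (θ/(1−θ)) Z_M`, `j_σ = −i c†_{aσ}c_{bσ} + i c†_{bσ}c_{aσ}`, `q ≥ κβ/ε`, `θ = ρ e^{κβ+ε} < 1`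
  (part 2's expansion: only commutator terms `[c_{yσ}, A]`, `y ∈ X`, survive; part 3's decay and ratio bounds; a geometric sum).
* §2 **The canonical-sector covariance bound.** In the `(M, M)` sector of `dΓ(h)` (`M ≤ n|Λ|/2`, `0 ≤ n ≤ 1`, `β ≥ 0`), the state being
  `gibbsState β (dΓ(h)|_p)` for ANY decidable presentation `p` of the sector: `ω_p(j) = 0` and
  `‖ω_p(A j) − ω_p(A) ω_p(j)‖ ≤ 8 (θ/(1−θ)) ‖A‖ |X| q^d` with `ρ = (n/(2−n)) e^{2κβ}` — uniformly in `|Λ|`.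

HONEST FRAMING: finite-dimensional statements about FREE lattice fermions in the non-degenerate (convergent fugacity) regime; nothing
here touches `U = 8`, the bet C8 or `T_c`; superconductivity in the Hubbard model is NOT proved (or disproved) by any of this.
-/

noncomputable section

namespace Summit.Ventures.CertifiedManyBodySolver.Theorems.TcThermcert1.FreeGasCurrentClustering

open NormedSpace Matrix Finset
open Literature.MathematicalPhysics.QuantumLattice
open Summit.HubbardSuperconductivity.HubbardSuperconductivity.Theorems.WidthHaldane
open scoped Matrix.Norms.L2Operator ComplexOrder

variable {Λ : Type*} [LinearOrder Λ] [Fintype Λ]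

/-! ## §1 The per-spin current bound along an intertwined family -/

section PerSpin

/-- A finite geometric sum: `Σ_{j<M} θ^{j+1} ≤ θ/(1−θ)` for `0 ≤ θ < 1`. -/
theorem sum_pow_succ_le {θ : ℝ} (h0 : 0 ≤ θ) (h1 : θ < 1) (M : ℕ) :
    ∑ j ∈ Finset.range M, θ ^ (j + 1) ≤ θ / (1 - θ) := by
  have hg := geom_sum_Ico_le_of_lt_one (m := 0) (n := M) h0 h1
  rw [pow_zero, ← Finset.range_eq_Ico] at hg
  calc ∑ j ∈ Finset.range M, θ ^ (j + 1) = θ * ∑ j ∈ Finset.range M, θ ^ j := by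
        rw [Finset.mul_sum]; exact Finset.sum_congr rfl fun j _ => by rw [pow_succ]; ring
    _ ≤ θ * (1 / (1 - θ)) := mul_le_mul_of_nonneg_left hg h0
    _ = θ / (1 - θ) := by rw [mul_one_div]

/-- Bounding a sum supported on `X` by `|X|` times a constant. -/
theorem sum_le_card_mul {f : Λ → ℝ} {X : Finset Λ} {K : ℝ} (hf : ∀ y, f y ≤ if y ∈ X then K else 0) :
    ∑ y, f y ≤ X.card * K := by
  calc ∑ y, f y ≤ ∑ y, (if y ∈ X then K else 0) := Finset.sum_le_sum fun y _ => hf y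
    _ = X.card * K := by
        rw [Finset.sum_ite_mem, Finset.univ_inter, Finset.sum_const, nsmul_eq_mul]

/-- **Per-spin current bound.** See the module docstring; `T_m(B) = tr(P_m e^{−βdΓ(h)} B)`, `E = e^{−βh}`. -/
theorem norm_trace_current_le (h : Matrix (Orb Λ) (Orb Λ) ℂ) (hsym : ∀ q k : Orb Λ, h q k = h k q)
    (hspin : ∀ q k : Orb Λ, (ofLex q).2 ≠ (ofLex k).2 → h q k = 0) {κ : ℝ} (hκ : 0 ≤ κ) (hrow : ∀ q, ∑ k, ‖h q k‖ ≤ κ)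
    (D : Λ → Λ → ℕ) (hD0 : ∀ x, D x x = 0) (hDt : ∀ x y z, D x z ≤ D x y + D y z)
    (hstep : ∀ l k : Orb Λ, h l k ≠ 0 → D (ofLex l).1 (ofLex k).1 ≤ 1)
    {β ε q : ℝ} (hβ : 0 ≤ β) (hε : 0 < ε) (hq : κ * β / ε ≤ q) (σ : Fin 2)
    (P : ℕ → Matrix (Finset (Orb Λ)) (Finset (Orb Λ)) ℂ)
    (hPc : ∀ (m : ℕ) (x : Λ), P m * annihilation (orb x σ) = annihilation (orb x σ) * P (m + 1))
    (hP0 : ∀ x : Λ, annihilation (orb x σ) * P 0 = 0) (Z : ℕ → ℝ) (hZ0 : ∀ m, 0 ≤ Z m)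
    (hT : ∀ (m : ℕ) (B : Matrix (Finset (Orb Λ)) (Finset (Orb Λ)) ℂ), ‖(P m * gibbsWeight β (dGamma h) * B).trace‖ ≤ ‖B‖ * Z m)
    {ρ : ℝ} (hρ0 : 0 ≤ ρ) {M : ℕ} (hρ : ∀ i : ℕ, i ≤ M → Z (M - i) ≤ ρ ^ i * Z M)
    (hθ : ρ * Real.exp (κ * β + ε) < 1)
    {X : Finset Λ} {A : Matrix (Finset (Orb Λ)) (Finset (Orb Λ)) ℂ} (hA : A ∈ carEvenSubalgebra (orbSet X))
    (a b : Λ) {d : ℕ} (hda : ∀ y ∈ X, d ≤ D a y) (hdb : ∀ y ∈ X, d ≤ D b y) :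
    ‖(P M * gibbsWeight β (dGamma h) *
        (A * ((-Complex.I) • (creation (orb a σ) * annihilation (orb b σ)) + Complex.I • (creation (orb b σ) * annihilation (orb a σ))))).trace‖ ≤
      4 * ‖A‖ * X.card * q ^ d * (ρ * Real.exp (κ * β + ε) / (1 - ρ * Real.exp (κ * β + ε))) * Z M := by
  -- spin-block structure and symmetry of `E = e^{−βh}`
  have hE : ∀ q k : Orb Λ, (ofLex q).2 ≠ (ofLex k).2 → (exp (-((β : ℂ) • h))) q k = 0 := fun q k hqk => by
    rw [← neg_smul]; exact exp_smul_apply_of_spin_ne h hspin _ hqk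
  have hsymm : ∀ j : ℕ, ((exp (-((β : ℂ) • h))) ^ (j + 1)) (orb a σ) (orb b σ) =
      ((exp (-((β : ℂ) • h))) ^ (j + 1)) (orb b σ) (orb a σ) := fun j => by
    rw [exp_neg_smul_pow]; exact exp_smul_apply_comm h hsym _ _ _
  rw [trace_P_mul_gibbsWeight_dGamma_mul_current β h hE σ P hPc hP0 A a b hsymm M, norm_mul, Complex.norm_I, one_mul]
  -- abbreviations
  set W := gibbsWeight β (dGamma h) with hW
  set θ : ℝ := ρ * Real.exp (κ * β + ε) with hθdef
  have hθ0 : 0 ≤ θ := by positivity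
  have hq0 : 0 ≤ q := le_trans (div_nonneg (by positivity) hε.le) hq
  have hA0 := norm_nonneg A
  -- the per-term bound
  have hterm : ∀ (j : ℕ), j < M → ∀ (u v : Λ), (∀ y ∈ X, d ≤ D u y) → ∀ y : Λ,
      ‖((exp (-((β : ℂ) • h))) ^ (j + 1)) (orb u σ) (orb y σ) *
          (P (M - (j + 1)) * W * ((annihilation (orb y σ) * A - A * annihilation (orb y σ)) * creation (orb v σ))).trace‖ ≤
        if y ∈ X then q ^ d * Real.exp ((κ * β + ε) * (j + 1)) * (2 * ‖A‖ * (ρ ^ (j + 1) * Z M)) else 0 := by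
    intro j hj u v hdu y
    by_cases hy : y ∈ X
    · rw [if_pos hy, norm_mul]
      refine mul_le_mul (norm_pow_exp_apply_le h hκ hrow D hD0 hDt hstep hβ hε hq j (orb u σ) (orb y σ) (hdu y hy)) ?_
        (norm_nonneg _) (by positivity)
      calc ‖(P (M - (j + 1)) * W * ((annihilation (orb y σ) * A - A * annihilation (orb y σ)) * creation (orb v σ))).trace‖
          ≤ ‖(annihilation (orb y σ) * A - A * annihilation (orb y σ)) * creation (orb v σ)‖ * Z (M - (j + 1)) := hT _ _
        _ ≤ (2 * ‖A‖) * (ρ ^ (j + 1) * Z M) :=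
            mul_le_mul (norm_commutator_mul_creation_le A _ _) (hρ (j + 1) (by omega)) (hZ0 _) (by positivity)
    · rw [if_neg hy, commutator_eq_zero_of_not_mem hA hy σ, Matrix.zero_mul, Matrix.mul_zero, Matrix.trace_zero, mul_zero, norm_zero]
  -- sum over `j < M` and over the sites
  calc ‖∑ j ∈ Finset.range M, (-1 : ℂ) ^ j * ∑ y : Λ,
          (((exp (-((β : ℂ) • h))) ^ (j + 1)) (orb a σ) (orb y σ) *
              (P (M - (j + 1)) * W * ((annihilation (orb y σ) * A - A * annihilation (orb y σ)) * creation (orb b σ))).trace -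
            ((exp (-((β : ℂ) • h))) ^ (j + 1)) (orb b σ) (orb y σ) *
              (P (M - (j + 1)) * W * ((annihilation (orb y σ) * A - A * annihilation (orb y σ)) * creation (orb a σ))).trace)‖
      ≤ ∑ j ∈ Finset.range M, ∑ y : Λ,
          (‖((exp (-((β : ℂ) • h))) ^ (j + 1)) (orb a σ) (orb y σ) *
              (P (M - (j + 1)) * W * ((annihilation (orb y σ) * A - A * annihilation (orb y σ)) * creation (orb b σ))).trace‖ +
            ‖((exp (-((β : ℂ) • h))) ^ (j + 1)) (orb b σ) (orb y σ) *
              (P (M - (j + 1)) * W * ((annihilation (orb y σ) * A - A * annihilation (orb y σ)) * creation (orb a σ))).trace‖) := by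
        refine (norm_sum_le _ _).trans (Finset.sum_le_sum fun j _ => ?_)
        rw [norm_mul, norm_pow, norm_neg, norm_one, one_pow, one_mul]
        exact (norm_sum_le _ _).trans (Finset.sum_le_sum fun y _ => norm_sub_le _ _)
    _ ≤ ∑ j ∈ Finset.range M, 2 * (X.card * (q ^ d * Real.exp ((κ * β + ε) * (j + 1)) * (2 * ‖A‖ * (ρ ^ (j + 1) * Z M)))) := by
        refine Finset.sum_le_sum fun j hj => ?_
        rw [Finset.sum_add_distrib, two_mul]
        exact add_le_add (sum_le_card_mul (hterm j (Finset.mem_range.1 hj) a b hda))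
          (sum_le_card_mul (hterm j (Finset.mem_range.1 hj) b a hdb))
    _ = 4 * ‖A‖ * X.card * q ^ d * Z M * ∑ j ∈ Finset.range M, θ ^ (j + 1) := by
        rw [Finset.mul_sum]
        refine Finset.sum_congr rfl fun j _ => ?_
        rw [hθdef, mul_pow, ← Real.exp_nat_mul]
        push_cast
        ring_nf
    _ ≤ 4 * ‖A‖ * X.card * q ^ d * Z M * (θ / (1 - θ)) :=
        mul_le_mul_of_nonneg_left (sum_pow_succ_le hθ0 hθ M) (by have := hZ0 M; positivity)
    _ = 4 * ‖A‖ * X.card * q ^ d * (θ / (1 - θ)) * Z M := by ring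

/-- **The bond current has zero expectation along every intertwined family**: `tr(P_M e^{−βdΓ(h)} j_σ) = 0` (part 2's expansion with
`A = 1`: every commutator `[c_{yσ}, 1]` vanishes). -/
theorem trace_current_eq_zero (h : Matrix (Orb Λ) (Orb Λ) ℂ) (hsym : ∀ q k : Orb Λ, h q k = h k q)
    (hspin : ∀ q k : Orb Λ, (ofLex q).2 ≠ (ofLex k).2 → h q k = 0) (β : ℝ) (σ : Fin 2) (P : ℕ → Matrix (Finset (Orb Λ)) (Finset (Orb Λ)) ℂ)
    (hPc : ∀ (m : ℕ) (x : Λ), P m * annihilation (orb x σ) = annihilation (orb x σ) * P (m + 1))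
    (hP0 : ∀ x : Λ, annihilation (orb x σ) * P 0 = 0) (a b : Λ) (M : ℕ) :
    (P M * gibbsWeight β (dGamma h) *
        ((-Complex.I) • (creation (orb a σ) * annihilation (orb b σ)) + Complex.I • (creation (orb b σ) * annihilation (orb a σ)))).trace = 0 := by
  have hE : ∀ q k : Orb Λ, (ofLex q).2 ≠ (ofLex k).2 → (exp (-((β : ℂ) • h))) q k = 0 := fun q k hqk => by
    rw [← neg_smul]; exact exp_smul_apply_of_spin_ne h hspin _ hqk
  have hsymm : ∀ j : ℕ, ((exp (-((β : ℂ) • h))) ^ (j + 1)) (orb a σ) (orb b σ) =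
      ((exp (-((β : ℂ) • h))) ^ (j + 1)) (orb b σ) (orb a σ) := fun j => by
    rw [exp_neg_smul_pow]; exact exp_smul_apply_comm h hsym _ _ _
  have h1 := trace_P_mul_gibbsWeight_dGamma_mul_current β h hE σ P hPc hP0 1 a b hsymm M
  rw [Matrix.one_mul] at h1
  rw [h1]
  simp only [Matrix.mul_one, Matrix.one_mul, sub_self, Matrix.zero_mul, Matrix.trace_zero, mul_zero,
    Finset.sum_const_zero]

end PerSpin

/-! ## §2 The canonical-sector covariance bound -/

section Covariance

/-- The Gibbs weight of a sector-preserving `H` has no entries from a sector to its complement. -/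
theorem gibbsWeight_toBlock_compl_eq_zero {H : Matrix (Finset (Orb Λ)) (Finset (Orb Λ)) ℂ} (hP : PreservesSectors H) (β : ℝ)
    {M N : ℕ} (p : Finset (Orb Λ) → Prop) [DecidablePred p] (hp : ∀ s, p s ↔ (upPart s).card = M ∧ (downPart s).card = N) :
    (gibbsWeight β H).toBlock p (fun s => ¬ p s) = 0 := by
  ext s t
  have hc := congrFun (congrFun (spinSectorProj_mul_gibbsWeight_comm hP β M N) s.1) t.1
  rw [spinSectorProj_eq_indicator p hp, diagonal_mul, mul_diagonal, if_pos s.2, if_neg t.2, one_mul, mul_zero] at hc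
  rw [toBlock_apply, hc, Matrix.zero_apply]

/-- **Dictionary**: the compressed Gibbs state of a sector-preserving `H` is the projected trace,
`gibbsState β H_p O_p = tr(P e^{−βH} O) / tr(P e^{−βH})` with `P = P_{M,N}` the projection of the sector presented by `p`. -/
theorem gibbsState_toBlock_eq_sectorTrace {H : Matrix (Finset (Orb Λ)) (Finset (Orb Λ)) ℂ} (hP : PreservesSectors H) (β : ℝ)
    {M N : ℕ} (p : Finset (Orb Λ) → Prop) [DecidablePred p] (hp : ∀ s, p s ↔ (upPart s).card = M ∧ (downPart s).card = N)
    (O : Matrix (Finset (Orb Λ)) (Finset (Orb Λ)) ℂ) :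
    gibbsState β (H.toBlock p p) (O.toBlock p p) =
      ((spinSectorProj M N * gibbsWeight β H).trace)⁻¹ * (spinSectorProj M N * gibbsWeight β H * O).trace := by
  rw [gibbsState_apply, ← trace_spinSectorProj_mul_gibbsWeight hP β p hp,
    ← toBlock_gibbsWeight_of_toBlock_compl_eq_zero β H p (toBlock_compl_eq_zero_of_preservesSectors hP p hp)]
  congr 1
  have hmul : (gibbsWeight β H * O).toBlock p p = (gibbsWeight β H).toBlock p p * O.toBlock p p := by
    rw [toBlock_mul_eq_add p p p (gibbsWeight β H) O, gibbsWeight_toBlock_compl_eq_zero hP β p hp, Matrix.zero_mul, add_zero]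
  rw [← hmul, ← trace_indicator_mul_eq_trace_toBlock p, ← spinSectorProj_eq_indicator p hp, Matrix.mul_assoc]

/-- **The canonical-sector current covariance bound for a short-range free gas.** In the `(M, M)` sector of `dΓ(h)`, presented by any
decidable predicate `p`, with `M ≤ n|Λ|/2`, `0 ≤ n ≤ 1`, `β ≥ 0`, `ε > 0`, `q ≥ κβ/ε` and `θ = (n/(2−n)) e^{2κβ} e^{κβ+ε} < 1`: for every
even observable `A` on `orbSet X` and bond sites `a, b` at `D`-distance `≥ d` from `X`,
`‖ω_p(A j) − ω_p(A) ω_p(j)‖ ≤ 8 (θ/(1−θ)) ‖A‖ |X| q^d`, `j = Σ_σ (−i c†_{aσ}c_{bσ} + i c†_{bσ}c_{aσ})` — uniformly in `|Λ|`. -/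
theorem norm_sectorCov_current_le (h : Matrix (Orb Λ) (Orb Λ) ℂ) (hh : h.IsHermitian) (hsym : ∀ q k : Orb Λ, h q k = h k q)
    (hspin : ∀ q k : Orb Λ, (ofLex q).2 ≠ (ofLex k).2 → h q k = 0) {κ : ℝ} (hκ : 0 ≤ κ) (hrow : ∀ q, ∑ k, ‖h q k‖ ≤ κ)
    (D : Λ → Λ → ℕ) (hD0 : ∀ x, D x x = 0) (hDt : ∀ x y z, D x z ≤ D x y + D y z)
    (hstep : ∀ l k : Orb Λ, h l k ≠ 0 → D (ofLex l).1 (ofLex k).1 ≤ 1)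
    {β n ε q : ℝ} (hβ : 0 ≤ β) (hn0 : 0 ≤ n) (hn1 : n ≤ 1) (hε : 0 < ε) (hq : κ * β / ε ≤ q)
    (hθ : n / (2 - n) * Real.exp (2 * κ * β) * Real.exp (κ * β + ε) < 1) {M : ℕ} (hM : (M : ℝ) ≤ n * (Fintype.card Λ : ℝ) / 2)
    (p : Finset (Orb Λ) → Prop) [DecidablePred p] (hp : ∀ s, p s ↔ (upPart s).card = M ∧ (downPart s).card = M)
    {X : Finset Λ} {A : Matrix (Finset (Orb Λ)) (Finset (Orb Λ)) ℂ} (hA : A ∈ carEvenSubalgebra (orbSet X))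
    (a b : Λ) {d : ℕ} (hda : ∀ y ∈ X, d ≤ D a y) (hdb : ∀ y ∈ X, d ≤ D b y) :
    ‖gibbsState β ((dGamma h).toBlock p p)
          ((A * (∑ σ : Fin 2, ((-Complex.I) • (creation (orb a σ) * annihilation (orb b σ)) +
            Complex.I • (creation (orb b σ) * annihilation (orb a σ))))).toBlock p p) -
        gibbsState β ((dGamma h).toBlock p p) (A.toBlock p p) *
          gibbsState β ((dGamma h).toBlock p p)
            ((∑ σ : Fin 2, ((-Complex.I) • (creation (orb a σ) * annihilation (orb b σ)) +
              Complex.I • (creation (orb b σ) * annihilation (orb a σ)))).toBlock p p)‖ ≤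
      8 * (n / (2 - n) * Real.exp (2 * κ * β) * Real.exp (κ * β + ε) /
          (1 - n / (2 - n) * Real.exp (2 * κ * β) * Real.exp (κ * β + ε))) * ‖A‖ * X.card * q ^ d := by
  have hH := isHermitian_dGamma hh
  have hP := preservesSectors_dGamma_of_spinDiag h hspin
  set ρ : ℝ := n / (2 - n) * Real.exp (2 * κ * β) with hρdef
  have hn2 : (0 : ℝ) < 2 - n := by linarith
  have hρ0 : 0 ≤ ρ := by positivity
  have hθ' : ρ * Real.exp (κ * β + ε) < 1 := hθ
  set W := gibbsWeight β (dGamma h) with hW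
  -- the two intertwined families and their bounds
  have bound_up := norm_trace_current_le h hsym hspin hκ hrow D hD0 hDt hstep hβ hε hq 0 (fun m => spinSectorProj m M)
    (fun m x => spinSectorProj_mul_annihilation_up m M x) (fun x => annihilation_up_mul_spinSectorProj_zero M x)
    (fun m => ((spinSectorProj m M * W).trace).re)
    (fun m => (Complex.nonneg_iff.1 (trace_spinSectorProj_mul_gibbsWeight_nonneg hH hP β m M)).1)
    (fun m B => norm_trace_spinSectorProj_mul_gibbsWeight_mul_le hH hP β m M B) hρ0
    (fun i hi => sectorTrace_up_sub_le h hh hsym hspin hκ hrow hβ hn0 hn1 hM M i hi) hθ' hA a b hda hdb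
  have bound_dn := norm_trace_current_le h hsym hspin hκ hrow D hD0 hDt hstep hβ hε hq 1 (fun m => spinSectorProj M m)
    (fun m x => spinSectorProj_mul_annihilation_down M m x) (fun x => annihilation_down_mul_spinSectorProj_zero M x)
    (fun m => ((spinSectorProj M m * W).trace).re)
    (fun m => (Complex.nonneg_iff.1 (trace_spinSectorProj_mul_gibbsWeight_nonneg hH hP β M m)).1)
    (fun m B => norm_trace_spinSectorProj_mul_gibbsWeight_mul_le hH hP β M m B) hρ0
    (fun i hi => sectorTrace_down_sub_le h hh hsym hspin hκ hrow hβ hn0 hn1 hM M i hi) hθ' hA a b hda hdb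
  have zero_up := trace_current_eq_zero h hsym hspin β 0 (fun m => spinSectorProj m M)
    (fun m x => spinSectorProj_mul_annihilation_up m M x) (fun x => annihilation_up_mul_spinSectorProj_zero M x) a b M
  have zero_dn := trace_current_eq_zero h hsym hspin β 1 (fun m => spinSectorProj M m)
    (fun m x => spinSectorProj_mul_annihilation_down M m x) (fun x => annihilation_down_mul_spinSectorProj_zero M x) a b M
  -- the sector traces
  set Z : ℝ := ((spinSectorProj M M * W).trace).re with hZdef
  have hZ0 : 0 ≤ Z := (Complex.nonneg_iff.1 (trace_spinSectorProj_mul_gibbsWeight_nonneg hH hP β M M)).1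
  have hZc : (spinSectorProj M M * W).trace = (Z : ℂ) := trace_spinSectorProj_mul_gibbsWeight_eq_re hH hP β M M
  -- the product term vanishes: `ω_p(j) = 0`
  have hJ : (spinSectorProj M M * W * (∑ σ : Fin 2, ((-Complex.I) • (creation (orb a σ) * annihilation (orb b σ)) +
      Complex.I • (creation (orb b σ) * annihilation (orb a σ))))).trace = 0 := by
    rw [Fin.sum_univ_two, Matrix.mul_add, Matrix.trace_add, zero_up, zero_dn, add_zero]
  rw [gibbsState_toBlock_eq_sectorTrace hP β p hp, gibbsState_toBlock_eq_sectorTrace hP β p hp, gibbsState_toBlock_eq_sectorTrace hP β p hp,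
    hJ, mul_zero, mul_zero, sub_zero, Matrix.mul_sum, Fin.sum_univ_two, Matrix.mul_add, Matrix.trace_add, hZc, norm_mul, norm_inv,
    Complex.norm_real, Real.norm_of_nonneg hZ0]
  -- `‖T₀ + T₁‖ / Z ≤ 8 θ/(1−θ) ‖A‖ |X| q^d`
  have hθ0 : 0 ≤ ρ * Real.exp (κ * β + ε) / (1 - ρ * Real.exp (κ * β + ε)) := div_nonneg (by positivity) (by linarith)
  have hq0 : 0 ≤ q := le_trans (div_nonneg (by positivity) hε.le) hq
  have hc0 : 0 ≤ 8 * (ρ * Real.exp (κ * β + ε) / (1 - ρ * Real.exp (κ * β + ε))) * ‖A‖ * X.card * q ^ d :=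
    mul_nonneg (mul_nonneg (mul_nonneg (mul_nonneg (by norm_num) hθ0) (norm_nonneg A)) (Nat.cast_nonneg _)) (pow_nonneg hq0 d)
  rw [inv_mul_eq_div]
  refine div_le_of_le_mul₀ hZ0 hc0 ?_
  refine (norm_add_le _ _).trans ?_
  calc _ ≤ 4 * ‖A‖ * X.card * q ^ d * (ρ * Real.exp (κ * β + ε) / (1 - ρ * Real.exp (κ * β + ε))) * Z +
        4 * ‖A‖ * X.card * q ^ d * (ρ * Real.exp (κ * β + ε) / (1 - ρ * Real.exp (κ * β + ε))) * Z := add_le_add bound_up bound_dn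
    _ = _ := by ring

end Covariance

end Summit.Ventures.CertifiedManyBodySolver.Theorems.TcThermcert1.FreeGasCurrentClustering

end
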